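import Summits.AnomalousDissipation.AnomalousDissipation.Theorems.CubicParityLoud.Negative.Clauses

/-!
# Negative knowledge for the crux `MomentParity.CubicParityLoud` (stmt-AnomalousDissipation-11465), II:
# the ENERGY ROW and the power ceiling

Certified copy of §2 of the cdisprove work file `Cruxes/CubicParityLoud/Disproof.lean`
(refuter-cdisprove-stmt-AnomalousDissipation-11465-0, cycle 1). Supports stmt-AnomalousDissipation-11465;
nothing here closes an item.

ENERGY ROW: for an `L²` force and a finite law on `H` carried by level-`N` fields with `‖u‖` integrable, the
row of the single quadratic observable `Σ_a (u,e_a)²` over the Galerkin frame of level `N` (an admissible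
test of the crux: the fields of `Torus.galerkinTest N`, polynomial `Σ Xᵢ²`, `totalDegree 2`) reads
`∫ [(u,f) − ν‖∇u‖²] dμ = 0`, i.e. `ensembleDissipation ν μ = ∫ (u, f) dμ`
(`ensembleDissipation_eq_of_energyRow`); with Cauchy–Schwarz, `ε ≤ ‖f‖₂ √E` for every witness
(`IsWitness.le_power`). Loudness is injected power, carried entirely by the mean flow's correlation with `f`.
-/

noncomputable section

namespace Summit.AnomalousDissipation.AnomalousDissipation.Theorems.CubicParityLoud.Negative

open MeasureTheory Filter UnitAddTorus
open scoped InnerProductSpace RealInnerProductSpace ENNReal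
open Literature.Analysis.FunctionSpaces Literature.Analysis.FluidPDE
open Summit.AnomalousDissipation.AnomalousDissipation.Theses.MomentParity

/-! ## §2 The ENERGY ROW: level-`N` + 3-stationary ⇒ `ensembleDissipation ν μ = ∫ (u, f) dμ`

The quadratic observable `p(u) = Σ_a (u, e_a)²` over the Galerkin frame `e_a` of level `N`
(`Torus.frameField`, a Parseval frame of `P_N H`) is an admissible test of the crux
(`totalDegree 2 + 1 ≤ 3`); its differential is `2 P_N u`, and on level-`N` fields `P_N u = u`, the
inertial term drops (`b(u,u,u) = 0` in the weak form `∫ (u⊗u):∇P_N u = ∫ ⟪D(P_N u) u, u − P_N u⟫`), so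
the row reads `∫ [(f,u) − ν‖∇u‖²] dμ = 0`. Consequences: dissipation = mean injected power
`(f, ū)` ≤ `‖f‖₂ √energy`; loudness is carried ENTIRELY by the correlation of the mean flow with `f`. -/

section EnergyRow

/-- Moments of order `≤ 3` from the cube: `t ^ p ≤ 1 + t ^ 3` for `p ≤ 3`, `t ≥ 0`. -/
theorem pow_le_one_add_cube {t : ℝ} (ht : 0 ≤ t) {p : ℕ} (hp : p ≤ 3) :
    t ^ p ≤ 1 + t ^ 3 := by
  rcases le_or_gt t 1 with h | h
  · calc t ^ p ≤ 1 := pow_le_one₀ ht h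
      _ ≤ 1 + t ^ 3 := le_add_of_nonneg_right (by positivity)
  · calc t ^ p ≤ t ^ 3 := pow_le_pow_right₀ h.le hp
      _ ≤ 1 + t ^ 3 := le_add_of_nonneg_left zero_le_one

/-- On a finite measure, `Integrable ‖u‖³ ⇒ Integrable ‖u‖ᵖ` for `p ≤ 3`. -/
theorem integrable_norm_pow_of_cube {μ : Measure H3} [IsFiniteMeasure μ]
    (h3 : Integrable (fun u : H3 => ‖u‖ ^ 3) μ) {p : ℕ} (hp : p ≤ 3) :
    Integrable (fun u : H3 => ‖u‖ ^ p) μ := by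
  refine Integrable.mono' ((integrable_const (1 : ℝ)).add h3)
    (continuous_norm.pow p).aestronglyMeasurable (ae_of_all _ fun u => ?_)
  rw [Real.norm_eq_abs, abs_of_nonneg (by positivity)]
  exact pow_le_one_add_cube (norm_nonneg u) hp

/-- The pairing `u ↦ (u, f)` with an `L²` force is integrable against any finite law with
integrable `‖u‖`. -/
theorem integrable_pairing {f : T3 → R3} (hf : MemLp f 2 volume) {μ : Measure H3} [IsFiniteMeasure μ]
    (h1 : Integrable (fun u : H3 => ‖u‖) μ) :
    Integrable (fun u : H3 => Torus.pairing u.1 f) μ := by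
  refine Integrable.mono' (h1.mul_const ‖hf.toLp f‖)
    (Torus.continuous_pairing_coe hf).aestronglyMeasurable (ae_of_all _ fun u => ?_)
  rw [Real.norm_eq_abs]
  exact Torus.abs_pairing_coe_le hf u

/-- The Galerkin frame of level `N` as a `Fin`-indexed family (the `g` of `Torus.galerkinTest`). -/
def frameG (N : ℕ) : Fin (Torus.galerkinTest (d := Fin 3) N one_pos).m → T3 → R3 :=
  (Torus.galerkinTest (d := Fin 3) N one_pos).g

/-- The energy polynomial `Σᵢ Xᵢ²`. -/
def energyPoly (n : ℕ) : MvPolynomial (Fin n) ℝ := ∑ i : Fin n, MvPolynomial.X i ^ 2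

/-- `Σ Xᵢ²` has total degree `≤ 2`, so it is an admissible test (`totalDegree + 1 ≤ 3`). -/
theorem totalDegree_energyPoly (n : ℕ) : (energyPoly n).totalDegree + 1 ≤ 3 := by
  have : (energyPoly n).totalDegree ≤ 2 := by
    refine (MvPolynomial.totalDegree_finsetSum _ _).trans ?_
    refine Finset.sup_le fun i _ => ?_
    rw [MvPolynomial.totalDegree_X_pow]
  omega

/-- `∂ᵢ (Σⱼ Xⱼ²) = 2 Xᵢ`, evaluated. -/
theorem eval_pderiv_energyPoly {n : ℕ} (v : Fin n → ℝ) (i : Fin n) :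
    MvPolynomial.eval v (MvPolynomial.pderiv i (energyPoly n)) = 2 * v i := by
  simp [energyPoly, map_sum, Derivation.leibniz_pow, MvPolynomial.pderiv_X, Pi.single_apply,
    Finset.sum_ite_eq', mul_comm]

/-- A single real mode `Re (e_k • z)` with `0 < |k| ≤ N` is band-limited to level `N`. -/
theorem mFourierCoeff_realTrigPoly_singleton_eq_zero_of_not_mem {N : ℕ} {k : Fin 3 → ℤ}
    (hk : k ∈ Torus.freqBall₀ (d := Fin 3) N) (z : (Fin 3 → ℤ) → EuclideanSpace ℂ (Fin 3))
    {k' : Fin 3 → ℤ} (hk' : k' ∉ (Torus.freqBall N).erase (0 : Fin 3 → ℤ)) :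
    mFourierCoeff (EuclideanSpace.complexify ∘ Torus.realTrigPoly {k} z) k' = 0 := by
  have hk0 : k ≠ 0 := (Finset.mem_erase.1 hk).1
  have hkB : k ∈ Torus.freqBall N := (Finset.mem_erase.1 hk).2
  refine Torus.mFourierCoeff_realTrigPoly_eq_zero_of_not_mem z ?_ ?_
  · rw [Finset.mem_singleton]
    rintro rfl
    exact hk' hk
  · rw [Finset.mem_singleton]
    intro h
    apply hk'
    rw [show k' = -k by rw [← h, neg_neg]]
    exact Finset.mem_erase.2 ⟨neg_ne_zero.2 hk0, Torus.neg_mem_freqBall.2 hkB⟩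

/-- The frame fields are admissible level-`N` tests. -/
theorem isBandTest_frameG (N : ℕ) (i : Fin (Torus.galerkinTest (d := Fin 3) N one_pos).m) :
    IsBandTest N (frameG N i) := by
  refine ⟨(Torus.galerkinTest (d := Fin 3) N one_pos).g_smooth i,
    (Torus.galerkinTest (d := Fin 3) N one_pos).g_divFree i,
    (Torus.galerkinTest (d := Fin 3) N one_pos).g_zeroMean i, fun k' hk' => ?_⟩
  change mFourierCoeff (EuclideanSpace.complexify ∘ Torus.frameField _ _ _) k' = 0
  exact mFourierCoeff_realTrigPoly_singleton_eq_zero_of_not_mem (Finset.coe_mem _) _ hk'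

/-- **The differential of the energy observable is `2 P_N u`** (for every `u ∈ H`). -/
theorem polyGrad_energy (N : ℕ) (u : H3) :
    polyGrad (frameG N) (energyPoly _) u =
      fun x => (2 : ℝ) • Torus.fourierTruncate N ((u : L2T3) : T3 → R3) x := by
  funext x
  simp only [polyGrad, eval_pderiv_energyPoly, mul_smul]
  rw [← Finset.smul_sum]
  congr 1
  have h := Torus.sum_galerkinTest_eq (d := Fin 3) N one_pos (fun g => Torus.pairing u.1 g • g x)
  change ∑ i, Torus.pairing u.1 ((Torus.galerkinTest (d := Fin 3) N one_pos).g i) •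
      (Torus.galerkinTest (d := Fin 3) N one_pos).g i x = _
  rw [h]
  exact Torus.sum_integral_inner_frameField_smul u.2 N x

/-- **The energy row integrand, for every `u ∈ H`**:
`⟨F(u), ∇p(u)⟩ = 2 ((f, P_N u) − ν ‖∇P_N u‖² + ∫ (u⊗u):∇P_N u)`. -/
theorem nsGeneratorPairing_energy (ν : ℝ) (f : T3 → R3) (N : ℕ) (u : H3) :
    Torus.nsGeneratorPairing ν f u (polyGrad (frameG N) (energyPoly _) u) =
      2 * ((∫ x, ⟪f x, Torus.fourierTruncate N ((u : L2T3) : T3 → R3) x⟫_ℝ) -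
        ν * (Torus.eGradNormSq (Torus.fourierTruncate N ((u : L2T3) : T3 → R3))).toReal +
        Torus.inertialPairing (u : L2T3) (Torus.fourierTruncate N ((u : L2T3) : T3 → R3))) := by
  rw [polyGrad_energy]
  exact Torus.nsGeneratorPairing_smul_fourierTruncate ν f u 2 N

/-- A level-`N` field has no tail enstrophy beyond `N`. -/
theorem tailGradNormSq_eq_zero_of_isLevel {N : ℕ} {u : H3} (hu : IsLevel N u) :
    Torus.tailGradNormSq N ((u : L2T3) : T3 → R3) = 0 := by
  rw [Torus.tailGradNormSq, ENNReal.tsum_eq_zero.2, mul_zero]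
  intro k
  have : mFourierCoeff (EuclideanSpace.complexify ∘ ((u : L2T3) : T3 → R3)) (k : Fin 3 → ℤ) = 0 :=
    hu k (fun h => k.2 (Finset.mem_of_mem_erase h))
  rw [this]
  simp

/-- **A level-`N` field is its own truncation**, `P_N u = u` a.e. on `𝕋³`. -/
theorem fourierTruncate_ae_eq_of_isLevel {N : ℕ} {u : H3} (hu : IsLevel N u) :
    (fun x => Torus.fourierTruncate N ((u : L2T3) : T3 → R3) x) =ᵐ[volume] ((u : L2T3) : T3 → R3) := by
  have hmem : MemLp ((u : L2T3) : T3 → R3) 2 volume := Lp.memLp (u : L2T3)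
  have htail := tailGradNormSq_eq_zero_of_isLevel hu
  have hle := Torus.integral_norm_sq_fourierTruncate_sub_le hmem N (by rw [htail]; exact ENNReal.zero_ne_top)
  rw [htail, ENNReal.toReal_zero, zero_div] at hle
  have hint : Integrable (fun x => ‖Torus.fourierTruncate N ((u : L2T3) : T3 → R3) x -
      ((u : L2T3) : T3 → R3) x‖ ^ 2) volume :=
    ((Torus.memLp_fourierTruncate N _ 2).sub hmem).integrable_norm_pow two_ne_zero
  have h0 : ∫ x, ‖Torus.fourierTruncate N ((u : L2T3) : T3 → R3) x - ((u : L2T3) : T3 → R3) x‖ ^ 2 = 0 :=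
    le_antisymm hle (integral_nonneg fun _ => by positivity)
  have hae := (integral_eq_zero_iff_of_nonneg (fun _ => by positivity) hint).1 h0
  filter_upwards [hae] with x hx
  have hx' : ‖Torus.fourierTruncate N ((u : L2T3) : T3 → R3) x - ((u : L2T3) : T3 → R3) x‖ ^ 2 = 0 := hx
  exact sub_eq_zero.1 (norm_eq_zero.1 (pow_eq_zero_iff two_ne_zero |>.1 hx'))

/-- A level-`N` field and its truncation have the same spectral gradient norm. -/
theorem eGradNormSq_fourierTruncate_of_isLevel {N : ℕ} {u : H3} (hu : IsLevel N u) :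
    Torus.eGradNormSq (Torus.fourierTruncate N ((u : L2T3) : T3 → R3)) =
      Torus.eGradNormSq ((u : L2T3) : T3 → R3) := by
  have hint : Integrable ((u : L2T3) : T3 → R3) volume := (Lp.memLp (u : L2T3)).integrable one_le_two
  rw [Torus.eGradNormSq_eq_tsum, Torus.eGradNormSq_eq_tsum]
  congr 1
  refine tsum_congr fun k => ?_
  rw [Torus.mFourierCoeff_fourierTruncate hint]
  split_ifs with hk
  · rfl
  · rw [hu k (fun h => hk (Finset.mem_of_mem_erase h))]

/-- The spectral gradient norm of a level-`N` field is finite. -/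
theorem eGradNormSq_lt_top_of_isLevel {N : ℕ} {u : H3} (hu : IsLevel N u) :
    Torus.eGradNormSq ((u : L2T3) : T3 → R3) < ⊤ := by
  have hint : Integrable ((u : L2T3) : T3 → R3) volume := (Lp.memLp (u : L2T3)).integrable one_le_two
  rw [← eGradNormSq_fourierTruncate_of_isLevel hu, Torus.fourierTruncate_eq,
    Torus.eGradNormSq_realTrigPoly Torus.neg_mem_freqBall_of_mem (Torus.isConjSymm_mFourierCoeff hint)]
  exact ENNReal.ofReal_lt_top

/-- On a level-`N` field the inertial term against the energy test vanishes: `b(u,u,u) = 0`. -/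
theorem inertialPairing_fourierTruncate_of_isLevel {N : ℕ} {u : H3} (hu : IsLevel N u) :
    Torus.inertialPairing (u : L2T3) (Torus.fourierTruncate N ((u : L2T3) : T3 → R3)) = 0 := by
  rw [Torus.inertialPairing_fourierTruncate_eq u.2 N]
  refine integral_eq_zero_of_ae ?_
  filter_upwards [fourierTruncate_ae_eq_of_isLevel hu] with x hx
  simp only [Pi.zero_apply]
  rw [show ((u : L2T3) : T3 → R3) x - Torus.fourierTruncate N ((u : L2T3) : T3 → R3) x = 0 by
    rw [hx, sub_self]]
  exact inner_zero_right _

/-- On a level-`N` field the force term of the energy test is the pairing `(u, f)`. -/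
theorem integral_inner_fourierTruncate_of_isLevel {N : ℕ} {u : H3} (hu : IsLevel N u) (f : T3 → R3) :
    (∫ x, ⟪f x, Torus.fourierTruncate N ((u : L2T3) : T3 → R3) x⟫_ℝ) = Torus.pairing u.1 f := by
  rw [Torus.pairing]
  refine integral_congr_ae ?_
  filter_upwards [fourierTruncate_ae_eq_of_isLevel hu] with x hx
  rw [hx, real_inner_comm]

/-- **The energy row integrand on level-`N` fields**: `⟨F(u), ∇p(u)⟩ = 2 ((u,f) − ν‖∇u‖²)`. -/
theorem nsGeneratorPairing_energy_of_isLevel (ν : ℝ) (f : T3 → R3) {N : ℕ} {u : H3} (hu : IsLevel N u) :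
    Torus.nsGeneratorPairing ν f u (polyGrad (frameG N) (energyPoly _) u) =
      2 * (Torus.pairing u.1 f - ν * (Torus.eGradNormSq ((u : L2T3) : T3 → R3)).toReal) := by
  rw [nsGeneratorPairing_energy, integral_inner_fourierTruncate_of_isLevel hu,
    eGradNormSq_fourierTruncate_of_isLevel hu, inertialPairing_fourierTruncate_of_isLevel hu, add_zero]

/-- **THE ENERGY ROW.** For an `L²` force `f`, any finite law on `H` carried by level-`N` fields,
with `‖u‖` integrable, whose row of the single quadratic observable `Σ_a (u,e_a)²` (Galerkin frame
of level `N`) is integrable with zero mean, satisfies `ensembleDissipation ν μ = ∫ (u, f) dμ`.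
Any proof of `CubicParityLoud` must produce laws whose loudness `ε` is injected power `(f, ū)`. -/
theorem ensembleDissipation_eq_of_energyRow {ν : ℝ} {f : T3 → R3} (hf : MemLp f 2 volume) {N : ℕ}
    {μ : Measure H3} [IsFiniteMeasure μ] (hlev : ∀ᵐ u ∂μ, IsLevel N u)
    (h1 : Integrable (fun u : H3 => ‖u‖) μ)
    (hrowI : Integrable (fun u => Torus.nsGeneratorPairing ν f u (polyGrad (frameG N) (energyPoly _) u)) μ)
    (hrow0 : ∫ u, Torus.nsGeneratorPairing ν f u (polyGrad (frameG N) (energyPoly _) u) ∂μ = 0) :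
    Torus.ensembleDissipation ν μ = ∫ u, Torus.pairing u.1 f ∂μ := by
  set G : H3 → ℝ := fun u => Torus.nsGeneratorPairing ν f u (polyGrad (frameG N) (energyPoly _) u) with hG
  set D : H3 → ℝ := fun u => (Torus.eGradNormSq ((u : L2T3) : T3 → R3)).toReal with hD
  have hae : G =ᵐ[μ] fun u => 2 * (Torus.pairing u.1 f - ν * D u) :=
    hlev.mono fun u hu => nsGeneratorPairing_energy_of_isLevel ν f hu
  have hpair : Integrable (fun u : H3 => Torus.pairing u.1 f) μ := integrable_pairing hf h1
  -- the dissipation as a Bochner integral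
  have hDint_eq : Torus.ensembleDissipation ν μ = ν * ∫ u, D u ∂μ := by
    unfold Torus.ensembleDissipation Torus.ensembleEnstrophy
    rw [integral_toReal Torus.measurable_eGradNormSq_coe.aemeasurable
      (hlev.mono fun u hu => eGradNormSq_lt_top_of_isLevel hu)]
  by_cases hν : ν = 0
  · -- then the row says `∫ (u,f) = 0`
    have h2 : Integrable (fun u : H3 => 2 * (Torus.pairing u.1 f - ν * D u)) μ := by
      simp only [hν, zero_mul, sub_zero]; exact hpair.const_mul 2
    have : ∫ u, G u ∂μ = 2 * ∫ u, Torus.pairing u.1 f ∂μ := by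
      rw [integral_congr_ae hae]
      simp only [hν, zero_mul, sub_zero]
      exact integral_const_mul 2 _
    rw [hDint_eq, hν, zero_mul]
    have h0 : 2 * ∫ u, Torus.pairing u.1 f ∂μ = 0 := by rw [← this]; exact hrow0
    linarith
  · -- `D = ((u,f) - G/2)/ν` is integrable and the row gives `ν ∫ D = ∫ (u,f)`
    have hGint : Integrable (fun u : H3 => 2 * (Torus.pairing u.1 f - ν * D u)) μ :=
      hrowI.congr hae
    have hDint : Integrable D μ := by
      have h3 : Integrable (fun u : H3 => (ν)⁻¹ * (Torus.pairing u.1 f -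
          (2 : ℝ)⁻¹ * (2 * (Torus.pairing u.1 f - ν * D u)))) μ :=
        (hpair.sub (hGint.const_mul _)).const_mul _
      refine h3.congr (ae_of_all _ fun u => ?_)
      simp only
      field_simp
      ring
    have hrow : ∫ u, 2 * (Torus.pairing u.1 f - ν * D u) ∂μ = 0 := by
      rw [← integral_congr_ae hae]; exact hrow0
    rw [integral_const_mul, integral_sub hpair (hDint.const_mul ν), integral_const_mul] at hrow
    rw [hDint_eq]
    linarith

/-- The energy row from the crux's full 3-stationarity clause. -/
theorem ensembleDissipation_eq_of_isStationary3 {ν : ℝ} {f : T3 → R3} (hf : MemLp f 2 volume) {N : ℕ}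
    {μ : Measure H3} [IsFiniteMeasure μ] (hlev : ∀ᵐ u ∂μ, IsLevel N u)
    (h1 : Integrable (fun u : H3 => ‖u‖) μ) (hstat : IsStationary3 ν f N μ) :
    Torus.ensembleDissipation ν μ = ∫ u, Torus.pairing u.1 f ∂μ := by
  obtain ⟨hI, h0⟩ := hstat _ (frameG N) (energyPoly _) (isBandTest_frameG N) (totalDegree_energyPoly _)
  exact ensembleDissipation_eq_of_energyRow hf hlev h1 hI h0

/-- `(∫ ‖u‖ dμ)² ≤ ∫ ‖u‖² dμ` on a probability space (variance is non-negative). -/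
theorem sq_integral_norm_le {μ : Measure H3} [IsProbabilityMeasure μ]
    (h2 : Integrable (fun u : H3 => ‖u‖ ^ 2) μ) :
    (∫ u, ‖u‖ ∂μ) ^ 2 ≤ ∫ u, ‖u‖ ^ 2 ∂μ := by
  have h1 : Integrable (fun u : H3 => ‖u‖) μ := by
    refine Integrable.mono' ((integrable_const (1 : ℝ)).add h2)
      continuous_norm.aestronglyMeasurable (ae_of_all _ fun u => ?_)
    rw [Real.norm_eq_abs, abs_of_nonneg (norm_nonneg _), Pi.add_apply]
    nlinarith [norm_nonneg u, sq_nonneg (‖u‖ - 1)]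
  set a : ℝ := ∫ u, ‖u‖ ∂μ with ha
  have hvar : 0 ≤ ∫ u, (‖u‖ - a) ^ 2 ∂μ := integral_nonneg fun _ => sq_nonneg _
  have hexp : ∫ u, (‖u‖ - a) ^ 2 ∂μ = (∫ u, ‖u‖ ^ 2 ∂μ) - a ^ 2 := by
    have hsplit : (fun u : H3 => (‖u‖ - a) ^ 2) = fun u => ‖u‖ ^ 2 - (2 * a) * ‖u‖ + a ^ 2 := by
      funext u; ring
    have hA : Integrable (fun u : H3 => ‖u‖ ^ 2 - 2 * a * ‖u‖) μ := h2.sub (h1.const_mul _)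
    rw [hsplit, integral_add hA (integrable_const _), integral_sub h2 (h1.const_mul _),
      integral_const_mul, integral_const, ← ha]
    simp only [smul_eq_mul, probReal_univ, one_mul]
    ring
  linarith

/-- `‖f‖_{L²} = √(∫ ‖f‖²)` for the `L²` class of an `L²` force. -/
theorem norm_toLp_eq_sqrt {f : T3 → R3} (hf : MemLp f 2 volume) :
    ‖hf.toLp f‖ = Real.sqrt (∫ x, ‖f x‖ ^ 2) := by
  have h : ∫ x, ‖f x‖ ^ 2 = ‖hf.toLp f‖ ^ 2 := by
    rw [← Torus.integral_norm_sq_coe_eq (hf.toLp f)]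
    refine integral_congr_ae ?_
    filter_upwards [hf.coeFn_toLp] with x hx
    rw [hx]
  rw [h, Real.sqrt_sq (norm_nonneg _)]

/-- **POWER CEILING**: `∫ (u, f) dμ ≤ ‖f‖_{L²} √(ensembleEnergy μ)` on a probability law with
integrable energy (Cauchy–Schwarz twice). With the energy row: `ε ≤ ‖f‖₂ √E` for every witness. -/
theorem integral_pairing_le {f : T3 → R3} (hf : MemLp f 2 volume) {μ : Measure H3} [IsProbabilityMeasure μ]
    (h2 : Integrable (fun u : H3 => ‖u‖ ^ 2) μ) :
    ∫ u, Torus.pairing u.1 f ∂μ ≤ Real.sqrt (∫ x, ‖f x‖ ^ 2) * Real.sqrt (Torus.ensembleEnergy μ) := by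
  have h1 : Integrable (fun u : H3 => ‖u‖) μ := by
    refine Integrable.mono' ((integrable_const (1 : ℝ)).add h2)
      continuous_norm.aestronglyMeasurable (ae_of_all _ fun u => ?_)
    rw [Real.norm_eq_abs, abs_of_nonneg (norm_nonneg _), Pi.add_apply]
    nlinarith [norm_nonneg u, sq_nonneg (‖u‖ - 1)]
  have hstep1 : ∫ u, Torus.pairing u.1 f ∂μ ≤ ∫ u, ‖u‖ * ‖hf.toLp f‖ ∂μ :=
    integral_mono (integrable_pairing hf h1) (h1.mul_const _) fun u =>
      (le_abs_self _).trans (Torus.abs_pairing_coe_le hf u)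
  rw [integral_mul_const] at hstep1
  have hstep2 : ∫ u, ‖u‖ ∂μ ≤ Real.sqrt (Torus.ensembleEnergy μ) := by
    unfold Torus.ensembleEnergy
    exact (le_abs_self _).trans (Real.abs_le_sqrt (sq_integral_norm_le h2))
  calc ∫ u, Torus.pairing u.1 f ∂μ ≤ (∫ u, ‖u‖ ∂μ) * ‖hf.toLp f‖ := hstep1
    _ ≤ Real.sqrt (Torus.ensembleEnergy μ) * ‖hf.toLp f‖ :=
        mul_le_mul_of_nonneg_right hstep2 (norm_nonneg _)
    _ = Real.sqrt (∫ x, ‖f x‖ ^ 2) * Real.sqrt (Torus.ensembleEnergy μ) := by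
        rw [norm_toLp_eq_sqrt, mul_comm]

/-- **CEILING FOR WITNESSES**: every witness of the crux at `(f, ν, N, E, ε)` has
`ε ≤ ensembleDissipation ν μ = ∫ (u,f) dμ ≤ ‖f‖₂ √E` (so `ε ≤ ‖f‖₂ √E`, and the mean flow is
non-trivially correlated with `f`). -/
theorem IsWitness.dissipation_eq {f : T3 → R3} (hf : MemLp f 2 volume) {ν : ℝ} {N : ℕ} {E ε : ℝ}
    {μ : Measure H3} (hW : IsWitness f ν N E ε μ) :
    Torus.ensembleDissipation ν μ = ∫ u, Torus.pairing u.1 f ∂μ := by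
  obtain ⟨hP, hlev, h3, hstat, -, -⟩ := hW
  exact ensembleDissipation_eq_of_isStationary3 hf hlev
    (by simpa using integrable_norm_pow_of_cube h3 (p := 1) (by norm_num)) hstat

/-- **POWER CEILING FOR WITNESSES**: `ε ≤ ‖f‖₂ √E`. -/
theorem IsWitness.le_power {f : T3 → R3} (hf : MemLp f 2 volume) {ν : ℝ} {N : ℕ} {E ε : ℝ}
    {μ : Measure H3} (hW : IsWitness f ν N E ε μ) :
    ε ≤ Real.sqrt (∫ x, ‖f x‖ ^ 2) * Real.sqrt E := by
  have hP := hW.1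
  have h2 : Integrable (fun u : H3 => ‖u‖ ^ 2) μ :=
    integrable_norm_pow_of_cube hW.2.2.1 (p := 2) (by norm_num)
  have hE : Torus.ensembleEnergy μ ≤ E := hW.2.2.2.2.1
  calc ε ≤ Torus.ensembleDissipation ν μ := hW.2.2.2.2.2
    _ = ∫ u, Torus.pairing u.1 f ∂μ := hW.dissipation_eq hf
    _ ≤ Real.sqrt (∫ x, ‖f x‖ ^ 2) * Real.sqrt (Torus.ensembleEnergy μ) := integral_pairing_le hf h2
    _ ≤ Real.sqrt (∫ x, ‖f x‖ ^ 2) * Real.sqrt E :=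
        mul_le_mul_of_nonneg_left (Real.sqrt_le_sqrt hE) (Real.sqrt_nonneg _)

end EnergyRow


end Summit.AnomalousDissipation.AnomalousDissipation.Theorems.CubicParityLoud.Negative
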